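import Summits.ResolutionOfSingularities.ResolutionOfSingularities.Theses.RuledResidues

/-!
# `RuledResidues.NonRuledDivisors` — line `contracted-divisor`, stub `stub_escapeInjective`

Strategist line `Cruxes/NonRuledDivisors/Lines/contracted-divisor.lean` (crux stmt-ResolutionOfSingularities-18075),
stub 3 proved verbatim (signature = the registered one).  ENGINE C (the escaping unit): let `τ` be a
ring automorphism of the field `K` inducing a local endomorphism of `S_P` (`τ r = a/s` with
`s ∉ P` and `r ∈ P ↔ a ∈ P`), `D ⊇ S_P` a valuation ring of `K` into whose maximal ideal `τ` contracts
`P`, and suppose some `s ∈ P` is a unit of `D`.  Then `n ↦ D.comap τⁿ` is injective: equal members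
`m < n` give `D = D.comap τᵈ` (`d = n - m ≥ 1`), and `τᵈ s = τ (τᵈ⁻¹ s) ∈ τ (P S_P) ⊆ 𝔪_D` would force
`s ∈ 𝔪_D`.
-/

-- dupNamespace: the problem namespace legitimately repeats the summit name
set_option linter.dupNamespace false

namespace Summit.ResolutionOfSingularities.ResolutionOfSingularities.Theorems

/-- Engine C of line `contracted-divisor` (crux `RuledResidues.NonRuledDivisors`): a valuation ring containing `S_P`, contracted into by a local endomorphism `τ` of `S_P` (`τ P ⊆ 𝔪_D`) but not dominating `P` (some `s ∈ P` is a `D`-unit), is not periodic under `W ↦ W.comap τ`. [folklore] -/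
theorem stub_escapeInjective : ∀ (K : Type) [Field K] (S : Subring K) (P : Ideal S) [P.IsPrime] (τ : K ≃+* K), (∀ r : S, ∃ a s : S, s ∉ P ∧ τ (r : K) * (s : K) = (a : K) ∧ (r ∈ P ↔ a ∈ P)) → ∀ D : ValuationSubring K, S ≤ D.toSubring → (∀ s : S, s ∉ P → (s : K) ∉ D.nonunits) → (∀ r : S, r ∈ P → τ (r : K) ∈ D.nonunits) → (∃ s : S, s ∈ P ∧ (s : K) ∉ D.nonunits) → Function.Injective (fun n : ℕ => D.comap ((τ ^ n : K ≃+* K) : K →+* K)) := by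
  intro K _ S P _ τ hloc D hle hunit hcon hesc
  -- elements of `S ∖ P` are nonzero units of `D`
  have hne : ∀ s : S, s ∉ P → (s : K) ≠ 0 := by
    intro s hs h0
    apply hs
    have : s = 0 := Subtype.ext h0
    rw [this]
    exact P.zero_mem
  have hvS : ∀ s : S, s ∉ P → D.valuation (s : K) = 1 := by
    intro s hs
    apply le_antisymm
    · exact (D.valuation_le_one_iff _).mpr (hle s.2)
    · exact not_lt.mp fun h => hunit s hs ((D.mem_nonunits_iff).mpr h)
  -- `1 ∉ P` (the locality hypothesis produces an element outside `P`)
  have h1 : (1 : S) ∉ P := by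
    obtain ⟨-, s0, hs0, -, -⟩ := hloc 0
    exact fun h1 => hs0 (by simpa using P.mul_mem_left s0 h1)
  -- the set `M = P · S_P ⊆ K`
  let M : Set K := {x | ∃ a t : S, a ∈ P ∧ t ∉ P ∧ x * (t : K) = (a : K)}
  have hPM : ∀ r : S, r ∈ P → (r : K) ∈ M := fun r hr => ⟨r, 1, hr, h1, by simp⟩
  -- `τ M ⊆ M` (uses primality of `P`)
  have hτM : ∀ x : K, x ∈ M → τ x ∈ M := by
    rintro x ⟨a, t, ha, ht, hx⟩
    obtain ⟨a₁, s₁, hs₁, ha₁, hiff₁⟩ := hloc a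
    obtain ⟨a₂, s₂, hs₂, ha₂, hiff₂⟩ := hloc t
    have ha₁P : a₁ ∈ P := hiff₁.mp ha
    have ha₂P : a₂ ∉ P := fun h => ht (hiff₂.mpr h)
    refine ⟨a₁ * s₂, s₁ * a₂, P.mul_mem_right _ ha₁P,
      fun h => (Ideal.IsPrime.mem_or_mem ‹P.IsPrime› h).elim hs₁ ha₂P, ?_⟩
    have hxt : τ x * τ (t : K) = τ (a : K) := by rw [← map_mul, hx]
    calc τ x * ((s₁ * a₂ : S) : K) = τ x * ((s₁ : K) * (τ (t : K) * (s₂ : K))) := by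
          rw [Subring.coe_mul, ha₂]
      _ = τ x * τ (t : K) * (s₁ : K) * (s₂ : K) := by ring
      _ = ((a₁ * s₂ : S) : K) := by rw [hxt, ha₁, Subring.coe_mul]
  -- `τ M ⊆ 𝔪_D`
  have hτMD : ∀ x : K, x ∈ M → τ x ∈ D.nonunits := by
    rintro x ⟨a, t, ha, ht, hx⟩
    obtain ⟨a₂, s₂, hs₂, ha₂, hiff₂⟩ := hloc t
    have ha₂P : a₂ ∉ P := fun h => ht (hiff₂.mpr h)
    have htne : τ (t : K) ≠ 0 := (map_ne_zero τ).mpr (hne t ht)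
    have hvt : D.valuation (τ (t : K)) = 1 := by
      have h := congrArg D.valuation ha₂
      rw [map_mul, hvS s₂ hs₂, mul_one] at h
      rw [h]
      exact hvS a₂ ha₂P
    have hxa : τ x = τ (a : K) * (τ (t : K))⁻¹ := by
      rw [eq_mul_inv_iff_mul_eq₀ htne, ← map_mul, hx]
    rw [ValuationSubring.mem_nonunits_iff, hxa, map_mul, map_inv₀, hvt, inv_one, mul_one]
    exact (D.mem_nonunits_iff).mp (hcon a ha)
  -- iterating: `τᵈ M ⊆ M`, hence `τᵈ s ∈ 𝔪_D` for `d ≥ 1` and `s ∈ P`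
  have hiter : ∀ d : ℕ, ∀ x : K, x ∈ M → (τ ^ d) x ∈ M := by
    intro d
    induction d with
    | zero => intro x hx; simpa using hx
    | succ d ih =>
      intro x hx
      rw [pow_succ, RingAut.mul_apply]
      exact ih _ (hτM x hx)
  have hpos : ∀ d : ℕ, 0 < d → ∀ r : S, r ∈ P → (τ ^ d) (r : K) ∈ D.nonunits := by
    intro d hd r hr
    obtain ⟨e, rfl⟩ := Nat.exists_eq_add_of_lt hd
    rw [Nat.zero_add, pow_succ', RingAut.mul_apply]
    exact hτMD _ (hiter e _ (hPM r hr))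
  -- no member of the orbit with positive index equals `D`
  have hkey : ∀ d : ℕ, 0 < d → D.comap ((τ ^ d : K ≃+* K) : K →+* K) ≠ D := by
    intro d hd heq
    obtain ⟨s, hsP, hsD⟩ := hesc
    apply hsD
    have h : (s : K) ∈ (D.comap ((τ ^ d : K ≃+* K) : K →+* K)).nonunits ↔
        (τ ^ d) (s : K) ∈ D.nonunits := by
      rw [ValuationSubring.mem_nonunits_iff_or, ValuationSubring.mem_nonunits_iff_or,
        ValuationSubring.mem_comap, map_inv₀, EmbeddingLike.map_eq_zero_iff]
      rfl
    rw [heq] at h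
    exact h.mpr (hpos d hd s hsP)
  -- two members with indices `m < n` differ (as in `Theorems.stub_contractingInjective`)
  have hlt : ∀ m n : ℕ, m < n →
      D.comap ((τ ^ m : K ≃+* K) : K →+* K) = D.comap ((τ ^ n : K ≃+* K) : K →+* K) → False := by
    intro m n hmn heq
    apply hkey (n - m) (Nat.sub_pos_of_lt hmn)
    ext z
    rw [ValuationSubring.mem_comap]
    have h := congrArg (fun A : ValuationSubring K => (τ ^ m).symm z ∈ A) heq
    simp only [ValuationSubring.mem_comap, eq_iff_iff] at h
    have hpow : τ ^ n = τ ^ (n - m) * τ ^ m := (pow_sub_mul_pow τ hmn.le).symm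
    have h2 : ((τ ^ n : K ≃+* K) : K →+* K) ((τ ^ m).symm z) = (τ ^ (n - m)) z := by
      rw [hpow]
      show (τ ^ (n - m)) ((τ ^ m) ((τ ^ m).symm z)) = _
      rw [RingEquiv.apply_symm_apply]
    have h3 : ((τ ^ m : K ≃+* K) : K →+* K) ((τ ^ m).symm z) = z := by
      show (τ ^ m) ((τ ^ m).symm z) = z
      rw [RingEquiv.apply_symm_apply]
    rw [h2, h3] at h
    exact h.symm
  intro m n hmn
  rcases Nat.lt_trichotomy m n with h | h | h
  · exact (hlt m n h hmn).elim
  · exact h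
  · exact (hlt n m h hmn.symm).elim

end Summit.ResolutionOfSingularities.ResolutionOfSingularities.Theorems
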